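import Summits.NavierStokesRegularity.NavierStokesRegularity.Theorems.SqueezeCycleExtremalBiaxialitySubcriticalPayerTomographyFarShell
import HarnessLib

/-!
# Route `SqueezeCycle`, crux `ExtremalBiaxialitySubcritical` — the far-shell bound on the sharp
# ball (line `oseen-shell-polar-tomography`, stub `stub_payerTomography`), III

Helper file for item `stmt-NavierStokesRegularity-11609`
(`Summit.NavierStokesRegularity.NavierStokesRegularity.Theses.SqueezeCycle.ExtremalBiaxialitySubcritical`).

* `tendsto_integral_radialCutoff_mul` — dominated convergence `θ_{s,R} → 1_{B_R}` (`s ↑ R`) for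
  `∫ θ_{s,R}(z) k(z) g(x − z) dz` with continuous `k`, `g`;
* `exists_farShell_bound` — an absolute constant `c_J` with
  `|∫_{|z|<R} D²Γ∞^{R/2,R}(z)(e,e) div((u·∇)u)(x − z) dz| ≤ c_J (M M₁/R + M²/R²)` for every
  divergence-free `u ∈ C²` with `|u| ≤ M`, `‖∇u‖ ≤ M₁` (the smoothly truncated bound of file II,
  kernel constants by scaling, `|B̄_R| = R³|B₁|`, and the limit `s → R⁻`).

Sources: calculus folklore.
-/

noncomputable section

open MeasureTheory Set Filter Metric Topology InnerProductSpace Function Real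
open scoped RealInnerProductSpace Laplacian ContDiff ENNReal NNReal

namespace Summit.NavierStokesRegularity.NavierStokesRegularity.Theorems

open Literature.Analysis Literature.Analysis.FluidPDE

set_option linter.dupNamespace false

-- nested operator types `ℝ³ →L[ℝ] ℝ³ →L[ℝ] ℝ³ →L[ℝ] ℝ³ →L[ℝ] ℝ`
set_option maxSynthPendingDepth 4

/-! ## Back to the sharp ball: the far-shell bound -/

section FarShell

set_option maxHeartbeats 400000 in
/-- **Removing the smooth truncation** (dominated convergence `s → R⁻`): for a continuous kernel
`k`, a continuous density `g` and `R > 0`,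
`∫ θ_{s,R}(z) k(z) g(x − z) dz → ∫_{|z|<R} k(z) g(x − z) dz` as `s ↑ R`
(`θ_{s,R} → 1_{B_R}` pointwise, everything bounded by `1_{B̄_R} sup|k| sup|g|`). [folklore] -/
theorem tendsto_integral_radialCutoff_mul {k g : EuclideanSpace ℝ (Fin 3) → ℝ}
    (hk : Continuous k) (hg : Continuous g) {R : ℝ} (hR : 0 < R) (x : EuclideanSpace ℝ (Fin 3)) :
    Tendsto (fun s => ∫ z, ((radialCutoff s R : EuclideanSpace ℝ (Fin 3) → ℝ) z * k z) * g (x - z))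
      (𝓝[<] R) (𝓝 (∫ z in ball (0 : EuclideanSpace ℝ (Fin 3)) R, k z * g (x - z))) := by
  -- bounds on the compact ball
  obtain ⟨Ck, hCk⟩ := (isCompact_closedBall (0 : EuclideanSpace ℝ (Fin 3)) R).exists_bound_of_continuousOn
    hk.continuousOn
  obtain ⟨Cg, hCg⟩ := (isCompact_closedBall (0 : EuclideanSpace ℝ (Fin 3)) R).exists_bound_of_continuousOn
    ((hg.comp (continuous_const.sub continuous_id)).continuousOn (s := closedBall 0 R))
  have hCk0 : 0 ≤ Ck := (norm_nonneg _).trans (hCk 0 (mem_closedBall_self hR.le))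
  have hCg0 : 0 ≤ Cg := (norm_nonneg _).trans (hCg 0 (mem_closedBall_self hR.le))
  rw [← integral_indicator measurableSet_ball]
  refine tendsto_integral_filter_of_dominated_convergence
    (fun z => (closedBall (0 : EuclideanSpace ℝ (Fin 3)) R).indicator (fun _ => Ck * Cg) z) ?_ ?_ ?_ ?_
  · exact Eventually.of_forall fun s =>
      (((radialCutoff_contDiff s R (n := 0)).continuous.mul hk).mul
        (hg.comp (continuous_const.sub continuous_id))).aestronglyMeasurable
  · filter_upwards [Ioo_mem_nhdsLT hR] with s hs
    refine Eventually.of_forall fun z => ?_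
    by_cases hz : z ∈ closedBall (0 : EuclideanSpace ℝ (Fin 3)) R
    · rw [indicator_of_mem hz, norm_mul, norm_mul]
      calc ‖(radialCutoff s R : EuclideanSpace ℝ (Fin 3) → ℝ) z‖ * ‖k z‖ * ‖g (x - z)‖
          ≤ 1 * Ck * Cg := by
            refine mul_le_mul (mul_le_mul ?_ (hCk z hz) (norm_nonneg _) zero_le_one) (hCg z hz)
              (norm_nonneg _) (by positivity)
            rw [Real.norm_eq_abs, abs_le]
            exact ⟨by linarith [radialCutoff_nonneg s R z], radialCutoff_le_one s R z⟩
        _ = Ck * Cg := by ring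
    · rw [indicator_of_notMem hz]
      rw [mem_closedBall_zero_iff, not_le] at hz
      rw [radialCutoff_eq_zero hs.1.le hs.2 hz.le, zero_mul, zero_mul, norm_zero]
  · exact (integrableOn_const (hs := measure_closedBall_lt_top.ne)).integrable_indicator
      measurableSet_closedBall
  · refine Eventually.of_forall fun z => ?_
    by_cases hz : ‖z‖ < R
    · have hmem : z ∈ ball (0 : EuclideanSpace ℝ (Fin 3)) R := mem_ball_zero_iff.2 hz
      rw [indicator_of_mem hmem]
      refine tendsto_const_nhds.congr' ?_
      filter_upwards [Ioo_mem_nhdsLT hz] with s hs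
      rw [radialCutoff_eq_one ((norm_nonneg z).trans hs.1.le) hs.2 hs.1.le, one_mul]
    · have hmem : z ∉ ball (0 : EuclideanSpace ℝ (Fin 3)) R := fun h => hz (mem_ball_zero_iff.1 h)
      rw [indicator_of_notMem hmem]
      refine tendsto_const_nhds.congr' ?_
      filter_upwards [Ioo_mem_nhdsLT hR] with s hs
      rw [radialCutoff_eq_zero hs.1.le hs.2 (not_lt.1 hz), zero_mul, zero_mul]

set_option maxHeartbeats 400000 in
/-- **The far-shell bound.** There is an absolute constant `c_J ≥ 0` such that for every
divergence-free `u ∈ C²(ℝ³; ℝ³)` with `|u| ≤ M` and `‖∇u‖ ≤ M₁`, every `R > 0`, `x` and unit `e`,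
`|∫_{|z|<R} D²Γ∞^{R/2,R}(z)(e,e) div((u·∇)u)(x − z) dz| ≤ c_J (M M₁/R + M²/R²)`
(`Γ∞^{R/2,R} = newtonFar (R/2·1) (R/2·2)`): the shell `R/2 ≤ |z| < R` and the sphere `|z| = R`
of the truncated quadrupole transform of `∂ᵢ∂ⱼ(uᵢuⱼ)`, bounded by two integrations by parts
behind the smooth truncations `θ_{s,R}`, `s ↑ R`. [folklore] -/
theorem exists_farShell_bound :
    ∃ cJ : ℝ, 0 ≤ cJ ∧ ∀ (u : EuclideanSpace ℝ (Fin 3) → EuclideanSpace ℝ (Fin 3)) (M M₁ R : ℝ)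
      (x e : EuclideanSpace ℝ (Fin 3)), ContDiff ℝ 2 u → VectorCalculus.IsDivFree u →
      (∀ y, ‖u y‖ ≤ M) → (∀ y, ‖fderiv ℝ u y‖ ≤ M₁) → 0 < R → ‖e‖ = 1 →
      |∫ z in Metric.ball (0 : EuclideanSpace ℝ (Fin 3)) R,
          fderiv ℝ (fderiv ℝ (newtonFar (R / 2 * 1) (R / 2 * 2))) z e e *
            VectorCalculus.divergence (convect u u) (x - z)| ≤
        cJ * (M * M₁ / R + M ^ 2 / R ^ 2) := by
  obtain ⟨-, -, ⟨M₂, hM₂⟩, ⟨M₃, hM₃⟩, ⟨M₄, hM₄⟩⟩ :=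
    exists_bound_newtonFar_derivs (r₀ := (1 : ℝ)) (r₁ := 2) one_pos one_lt_two
  have hM₂0 : 0 ≤ M₂ := (norm_nonneg _).trans (hM₂ 0)
  have hM₃0 : 0 ≤ M₃ := (norm_nonneg _).trans (hM₃ 0)
  have hM₄0 : 0 ≤ M₄ := (norm_nonneg _).trans (hM₄ 0)
  set v₁ : ℝ := (volume (ball (0 : EuclideanSpace ℝ (Fin 3)) 1)).toReal with hv₁
  have hv₁0 : 0 ≤ v₁ := ENNReal.toReal_nonneg
  refine ⟨v₁ * (48 * M₂ + (32 * M₄ + 96 * M₃)), by positivity, ?_⟩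
  intro u M M₁ R x e hu hdiv hM hM₁ hR he
  have hM0 : 0 ≤ M := (norm_nonneg _).trans (hM 0)
  have hM₁0 : 0 ≤ M₁ := (norm_nonneg _).trans (hM₁ 0)
  have h₀ : (0 : ℝ) < R / 2 * 1 := by linarith
  have h₁ : R / 2 * 1 < R / 2 * 2 := by linarith
  have hF : ContDiff ℝ 4 (newtonFar (R / 2 * 1) (R / 2 * 2)) := contDiff_newtonFar h₀ h₁
  obtain ⟨hB₂, hB₃, hB₄⟩ := newtonFar_half_derivs_le hR hM₂ hM₃ hM₄
  -- volume of the ball of radius `R`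
  have hvR : (volume (closedBall (0 : EuclideanSpace ℝ (Fin 3)) R)).toReal = R ^ 3 * v₁ := by
    rw [Measure.addHaar_closedBall _ _ hR.le, finrank_euclideanSpace_fin, ENNReal.toReal_mul,
      ENNReal.toReal_ofReal (by positivity), hv₁]
  -- the bound on the smoothly truncated integrals, `s ∈ [R/2, R)`
  have hJs : ∀ s ∈ Ico (R / 2) R,
      |∫ z, ((radialCutoff s R : EuclideanSpace ℝ (Fin 3) → ℝ) z *
          fderiv ℝ (fderiv ℝ (newtonFar (R / 2 * 1) (R / 2 * 2))) z e e) *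
          VectorCalculus.divergence (convect u u) (x - z)| ≤
        v₁ * (48 * M₂ + (32 * M₄ + 96 * M₃)) * (M * M₁ / R + M ^ 2 / R ^ 2) := by
    intro s hs
    have hs0 : 0 < s := by linarith [hs.1]
    refine (abs_integral_cutoff_hess_mul_divergence_convect_le hF hB₂ hB₃ hB₄ hs0 hs.2 he hu hdiv
      hM hM₁ x).trans ?_
    rw [hvR]
    -- `3 R³ v₁ / s ≤ 6 R² v₁` for `s ≥ R/2`
    have hsv : 3 * (R ^ 3 * v₁) / s ≤ 6 * R ^ 2 * v₁ := by
      rw [div_le_iff₀ hs0]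
      nlinarith [hs.1, mul_nonneg (sq_nonneg R) hv₁0]
    have e1 : 8 * M₂ / R ^ 3 * (M₁ * M) * (6 * R ^ 2 * v₁) = v₁ * (48 * M₂) * (M * M₁ / R) := by
      field_simp; ring
    have e2 : M ^ 2 * (32 * M₄ / R ^ 5 * (R ^ 3 * v₁) + 16 * M₃ / R ^ 4 * (6 * R ^ 2 * v₁)) =
        v₁ * (32 * M₄ + 96 * M₃) * (M ^ 2 / R ^ 2) := by
      field_simp; ring
    calc 8 * M₂ / R ^ 3 * (M₁ * M) * (3 * (R ^ 3 * v₁) / s) +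
          M ^ 2 * (32 * M₄ / R ^ 5 * (R ^ 3 * v₁) + 16 * M₃ / R ^ 4 * (3 * (R ^ 3 * v₁) / s))
        ≤ 8 * M₂ / R ^ 3 * (M₁ * M) * (6 * R ^ 2 * v₁) +
          M ^ 2 * (32 * M₄ / R ^ 5 * (R ^ 3 * v₁) + 16 * M₃ / R ^ 4 * (6 * R ^ 2 * v₁)) := by
          gcongr
      _ = v₁ * (48 * M₂) * (M * M₁ / R) + v₁ * (32 * M₄ + 96 * M₃) * (M ^ 2 / R ^ 2) := by
          rw [e1, e2]
      _ ≤ v₁ * (48 * M₂ + (32 * M₄ + 96 * M₃)) * (M * M₁ / R + M ^ 2 / R ^ 2) := by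
          have ha : 0 ≤ M * M₁ / R := by positivity
          have hb : 0 ≤ M ^ 2 / R ^ 2 := by positivity
          nlinarith [mul_nonneg (mul_nonneg hv₁0 hM₂0) hb, mul_nonneg (mul_nonneg hv₁0 hM₄0) ha,
            mul_nonneg (mul_nonneg hv₁0 hM₃0) ha]
  -- pass to the limit `s → R⁻`
  have hK : Continuous fun z => fderiv ℝ (fderiv ℝ (newtonFar (R / 2 * 1) (R / 2 * 2))) z e e :=
    (hessKernel_facts hF he).1.continuous
  have hG : Continuous (VectorCalculus.divergence (convect u u)) :=
    continuous_divergence ((contDiff_convect_self (n := 1) (by exact_mod_cast hu)).continuous_fderiv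
      one_ne_zero)
  have hlim := tendsto_integral_radialCutoff_mul hK hG hR x
  have hlim_abs := (continuous_abs.tendsto _).comp hlim
  refine le_of_tendsto hlim_abs ?_
  filter_upwards [Ico_mem_nhdsLT (show R / 2 < R by linarith)] with s hs
  exact hJs s hs

end FarShell

end Summit.NavierStokesRegularity.NavierStokesRegularity.Theorems

end
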